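import Summits.AtomisticToContinuum.Crystallization.Theorems.FrustratedLawDichotomyAveragingRuleCap
import Summits.AtomisticToContinuum.Crystallization.Theorems.FrustratedLawDichotomyMotifCount

/-!
# FrustratedLawDichotomy · `LAP^D` on motifs: FINITE in the motif size, and `C_T`-FREE after tight absorption (the census object, typed)

Continuation of `…AveragingRule` (p829595) / `…AveragingRuleCap` (p829695), hand-2 g13.  There: lens-5's ball-averaged pricing with CAPPED
flags, `LAP^D_ρ = BallAveragedPricingCap`, is motif-local (`ballAveragedPricingCap_iff_motif`) and its motif form
`BallAveragedMotifPricingCap ρ ϱ …` is LITERALLY the motif certificate of the motif door at the averaging rule.  This file SPECIALISES it to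
the object a census engine attacks (critic row 518 (4): TAG 181-S(iii)-AVG; row 516: TAG 181 (c)):

* §6 FINITE FAMILY: `ballAveragedMotifPricingCap_iff_bounded` — only motif sizes `M ≤ (20ϱ/7 + 1)³` occur (`…MotifCount.motif_card_le`).
* §7 TIGHT ABSORPTION WITH CAPPED FLAGS (lens-5 g35's piece (T), capped): the capped surplus has the same crude floors
  (`surplusCap_ge : x^D_j ≥ −Dfl`, `surplusCap_ge_of_good : x^D_j ≥ C_T − Dfl` at a capped-tightly-good site), so every ball / motif centre with a
  CAPPED-TIGHTLY-GOOD site within `ρ` has `S^D ≥ 0` as soon as `C_T ≥ C_T⁰(R,B,e,ρ)` (`tightAbsorptionCap`, PROVED — `C_T` is ELIMINATED exactly as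
  in `…AveragingCutC.tightAbsorption_holds`); in a capped-tight-free ball `C_T` is invisible (`ballAvg_surplusCap_eq_of_not_tightNearCap`).
* §8 THE `C_T`-FREE MOTIF PIECE `TightFreeMotifPricingCap ρ ϱ D W e` («every injective `7/10`-separated radius-`ϱ` motif whose centre's
  `ρ`-ball holds NO capped-tightly-good site has `S^D_centre(C_T = 0) ≥ 0`») and its lens-5-style split into `F1^D` (no capped-loosely-bad site
  in the ball either: strained patch) and `F2^D` (some capped-loosely-bad site: defect core) — `tightFreeMotifPricingCap_iff_pieces`;
  ★ `ballAveragedMotifPricingCap_of_tightFree` : `C_T ≥ C_T⁰ ∧ TightFreeMotifPricingCap ⟹ LAP^D on motifs`.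
* §9 BY NAME: ★★ `aperiodicFrustratedLawGap_fourHalf_of_tightFreeMotifCap` —
  `MuEquilibriumDoor ∧ SF₄₅ ∧ UP(−0.7175) ∧ E′♭₄₅ ∧ TightFreeMotifPricingCap ρ ϱ D W₄₅ e₄₅ ⟹ AperiodicFrustratedLawGap`
  (`0 ≤ ρ ≤ ρ₁`, `9/2 ≤ ρ₁`, `13/10·D + 1 ≤ ρ₁`, `ρ + ρ₁ ≤ ϱ`; `C_T := C_T⁴⁵(ρ)` discharged; literal one-shell instance `…_oneShell`:
  `ρ = 23/20, D = 3/2, ϱ = 113/20`), `T′♭₄₅` itself (`schurTopologicalPricing_fourHalf_of_tightFreeMotifCap`) and the range-5 twin.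
  After this file the energetic feed of column 27623 beneath `T′♭₄₅` reads, for the flat averaging rule: ONE finite-size family of `C_T`-free
  motif inequalities (plus `E′♭₄₅`, `SF₄₅`, `UP`, the door) — an `F2`-adversary of TAG 181-S(iii)-AVG is exactly a member of this family with
  `S^D < 0`.

[folklore] bookkeeping; 0 sorry.  Prover hand 2, gen 13 (decomp-a2c), `--supports stmt-AtomisticToContinuum-27623`.
-/

noncomputable section

namespace Summit.AtomisticToContinuum.Crystallization.Theorems.FrustratedLawDichotomyAveragingRuleTightFree

open scoped BigOperators Classical
open Literature.MathematicalPhysics.StatisticalMechanics (interactionEnergy siteEnergy)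
open Summit.AtomisticToContinuum.Crystallization.Theorems.ChargedEnergyGapNegative (E3)
open Summit.AtomisticToContinuum.Crystallization.Theorems.FrustratedLawDichotomyRangeCut
open Summit.AtomisticToContinuum.Crystallization.Theorems.FrustratedLawDichotomySchurCut
open Summit.AtomisticToContinuum.Crystallization.Theorems.FrustratedLawDichotomyLocalDischargingRule
open Summit.AtomisticToContinuum.Crystallization.Theorems.FrustratedLawDichotomyMotifLemmas
open Summit.AtomisticToContinuum.Crystallization.Theorems.FrustratedLawDichotomyMotifCount (motif_card_le)
open Summit.AtomisticToContinuum.Crystallization.Theorems.FrustratedLawDichotomyRuleToolkit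
open Summit.AtomisticToContinuum.Crystallization.Theorems.FrustratedLawDichotomyRuleToolkitGood
open Summit.AtomisticToContinuum.Crystallization.Theorems.FrustratedLawDichotomyAveragingCut
  (surplus ball ballAvg mem_ball card_ball_pos one_le_card_ball card_ball_le BallAveragedPricing CutBounds Mball one_le_Mball Dfl Dfl_pos
   CT₀ Dfl_le_CT₀ siteEnergy_ge sum_div_ge_of_one_large W₄₅_cutBounds W₅_cutBounds)
open Summit.AtomisticToContinuum.Crystallization.Theorems.FrustratedLawDichotomyAveragingRule
open Summit.AtomisticToContinuum.Crystallization.Theorems.FrustratedLawDichotomyAveragingRuleCap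

/-! ## §6. The motif family is finite in the motif size -/

/-- ★ **`LAP^D` on motifs is a finite family in the motif size**: only `M ≤ (20ϱ/7 + 1)³` occurs (`ϱ ≥ 0`). [folklore] -/
theorem ballAveragedMotifPricingCap_iff_bounded {ρ ϱ η₀ η₁ D : ℝ} {W : ℝ → ℝ} {e κT CT : ℝ} (hϱ : 0 ≤ ϱ) :
    BallAveragedMotifPricingCap ρ ϱ η₀ η₁ D W e κT CT ↔
      ∀ (M : ℕ), (M : ℝ) ≤ (20 * ϱ / 7 + 1) ^ 3 → ∀ (z : Fin M → E3), Function.Injective z → Sep z → ∀ c : Fin M,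
        (∀ a : Fin M, dist (z a) (z c) ≤ ϱ) → 0 ≤ ballAvg ρ z (surplusCap η₀ η₁ D W e κT CT M z) c :=
  ⟨fun h M _ z hz hsep c hconf => h M z hz hsep c hconf,
    fun h M z hz hsep c hconf => h M (motif_card_le hϱ hz hsep hconf) z hz hsep c hconf⟩

/-! ## §7. Tight absorption with capped flags (`C_T` eliminated) -/

/-- A CAPPED-TIGHTLY-GOOD site (`GoodAtScale (1/20) D`) within `ρ` of `i`. -/
def TightNearCap (ρ D : ℝ) {N : ℕ} (y : Fin N → E3) (i : Fin N) : Prop := ∃ j ∈ ball ρ y i, GoodAtScale (1 / 20) D y j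

/-- A CAPPED-LOOSELY-BAD site (`¬GoodAtScale (1/8) D`) within `ρ` of `i`. -/
def BadNearCap (ρ D : ℝ) {N : ℕ} (y : Fin N → E3) (i : Fin N) : Prop := ∃ j ∈ ball ρ y i, ¬GoodAtScale (1 / 8) D y j

/-- **Capped surplus floor**: `x^D_j(C_T) ≥ −Dfl R B e` under the hard core (`C_T ≥ 0`, slots `1/20, 1/8, κ_T = 1/100`). [folklore] -/
theorem surplusCap_ge {W : ℝ → ℝ} {R B e CT D : ℝ} (hW : CutBounds W R B) (hCT : 0 ≤ CT) {N : ℕ} {y : Fin N → E3} (hs : Sep y)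
    (j : Fin N) : -Dfl R B e ≤ surplusCap (1 / 20) (1 / 8) D W e (1 / 100) CT N y j := by
  have h := siteEnergy_ge hW hs j
  have hsite : (pairSumFeature W N y j - W 0) / 2 = siteEnergy W y j / 2 := by
    unfold pairSumFeature; rw [siteEnergy_eq]
  unfold surplusCap
  rw [hsite]
  unfold Dfl
  have hg1 := goodFlag_mem (η := 1 / 8) (D := D) y j
  have hg0 := goodFlag_mem (η := 1 / 20) (D := D) y j
  nlinarith [le_abs_self e, mul_nonneg hCT hg0.1]

/-- **Capped tight surplus**: a capped-tightly-good site carries `x^D_j(C_T) ≥ C_T − Dfl R B e`. [folklore] -/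
theorem surplusCap_ge_of_good {W : ℝ → ℝ} {R B e CT D : ℝ} (hW : CutBounds W R B) {N : ℕ} {y : Fin N → E3} (hs : Sep y) {j : Fin N}
    (hg : GoodAtScale (1 / 20) D y j) : CT - Dfl R B e ≤ surplusCap (1 / 20) (1 / 8) D W e (1 / 100) CT N y j := by
  have h := siteEnergy_ge hW hs j
  have hsite : (pairSumFeature W N y j - W 0) / 2 = siteEnergy W y j / 2 := by
    unfold pairSumFeature; rw [siteEnergy_eq]
  unfold surplusCap
  rw [hsite]
  unfold Dfl
  have hg1 := goodFlag_mem (η := 1 / 8) (D := D) y j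
  have hflag : goodFlag (1 / 20) D N y j = 1 := by unfold goodFlag; rw [if_pos hg]
  rw [hflag]
  nlinarith [le_abs_self e]

/-- ★ **TIGHT ABSORPTION, CAPPED (PROVED)**: in every injective `7/10`-separated cluster, every ball `B(i,ρ)` containing a capped-tightly-good
site has `S^D_i(C_T) ≥ 0` once `C_T ≥ C_T⁰(R,B,e,ρ) = Dfl·(1 + Mball ρ²)` (packing + crude floors; `ρ ≥ 0`). [folklore] -/
theorem tightAbsorptionCap {W : ℝ → ℝ} {R B e ρ CT D : ℝ} (hW : CutBounds W R B) (hρ : 0 ≤ ρ) (hCT : CT₀ R B e ρ ≤ CT)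
    {N : ℕ} {y : Fin N → E3} (hs : Sep y) {i : Fin N} (hT : TightNearCap ρ D y i) :
    0 ≤ ballAvg ρ y (surplusCap (1 / 20) (1 / 8) D W e (1 / 100) CT N y) i := by
  obtain ⟨a, ha, hga⟩ := hT
  have hD : 0 ≤ Dfl R B e := (Dfl_pos hW.range_nonneg hW.floor_nonneg).le
  have hDC := Dfl_le_CT₀ (e := e) hW.range_nonneg hW.floor_nonneg ρ
  have hCT0 : 0 ≤ CT := le_trans hD (hDC.trans hCT)
  have hM1 := one_le_Mball hρ
  have key := sum_div_ge_of_one_large (ball ρ y i) ha (surplusCap (1 / 20) (1 / 8) D W e (1 / 100) CT N y)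
    (fun j => ((ball ρ y j).card : ℝ)) (L := CT - Dfl R B e) (M := Mball ρ) (D := Dfl R B e) (by linarith) hD
    (fun j _ => by exact_mod_cast one_le_card_ball hρ y j) (card_ball_le hρ hs a) (card_ball_le hρ hs i)
    (fun j _ => surplusCap_ge hW hCT0 hs j) (surplusCap_ge_of_good hW hs hga)
  have hMpos : 0 < Mball ρ := by linarith
  have hbound : Mball ρ * Dfl R B e ≤ (CT - Dfl R B e) / Mball ρ := by
    rw [le_div_iff₀ hMpos]
    unfold CT₀ at hCT
    nlinarith
  unfold ballAvg
  linarith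

/-- In a CAPPED-TIGHT-FREE ball the allowance `C_T` is invisible: `S^D_i(C_T) = S^D_i(0)`. [folklore] -/
theorem ballAvg_surplusCap_eq_of_not_tightNearCap {W : ℝ → ℝ} {e ρ CT D : ℝ} {N : ℕ} {y : Fin N → E3} {i : Fin N}
    (h : ¬TightNearCap ρ D y i) :
    ballAvg ρ y (surplusCap (1 / 20) (1 / 8) D W e (1 / 100) CT N y) i = ballAvg ρ y (surplusCap (1 / 20) (1 / 8) D W e (1 / 100) 0 N y) i := by
  unfold ballAvg
  refine Finset.sum_congr rfl fun j hj => ?_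
  have hng : ¬GoodAtScale (1 / 20) D y j := fun hg => h ⟨j, hj, hg⟩
  simp only [surplusCap, goodFlag, if_neg hng, mul_zero, add_zero]

/-! ## §8. The `C_T`-free motif piece and its split into strained patch / defect core -/

/-- ★ **`TightFreeMotifPricingCap ρ ϱ D W e`** — THE `C_T`-FREE CENSUS OBJECT: every injective `7/10`-separated motif confined to radius `ϱ`
about its centre `c`, whose centre's `ρ`-ball holds NO capped-tightly-good site, has `S^D_c(0) ≥ 0` (slots `1/20, 1/8, κ_T = 1/100`). -/
def TightFreeMotifPricingCap (ρ ϱ D : ℝ) (W : ℝ → ℝ) (e : ℝ) : Prop :=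
  ∀ (M : ℕ) (z : Fin M → E3), Function.Injective z → Sep z → ∀ c : Fin M, (∀ a : Fin M, dist (z a) (z c) ≤ ϱ) →
    ¬TightNearCap ρ D z c → 0 ≤ ballAvg ρ z (surplusCap (1 / 20) (1 / 8) D W e (1 / 100) 0 M z) c

/-- **`F1^D` on motifs — STRAINED PATCH**: capped-tight-free AND capped-bad-free centre ball ⟹ `S^D_c(0) ≥ 0`. -/
def StrainedPatchMotifPricingCap (ρ ϱ D : ℝ) (W : ℝ → ℝ) (e : ℝ) : Prop :=
  ∀ (M : ℕ) (z : Fin M → E3), Function.Injective z → Sep z → ∀ c : Fin M, (∀ a : Fin M, dist (z a) (z c) ≤ ϱ) →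
    ¬TightNearCap ρ D z c → ¬BadNearCap ρ D z c → 0 ≤ ballAvg ρ z (surplusCap (1 / 20) (1 / 8) D W e (1 / 100) 0 M z) c

/-- **`F2^D` on motifs — DEFECT CORE**: capped-tight-free centre ball with a capped-loosely-bad site ⟹ `S^D_c(0) ≥ 0`. -/
def TightFreeDefectMotifPricingCap (ρ ϱ D : ℝ) (W : ℝ → ℝ) (e : ℝ) : Prop :=
  ∀ (M : ℕ) (z : Fin M → E3), Function.Injective z → Sep z → ∀ c : Fin M, (∀ a : Fin M, dist (z a) (z c) ≤ ϱ) →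
    ¬TightNearCap ρ D z c → BadNearCap ρ D z c → 0 ≤ ballAvg ρ z (surplusCap (1 / 20) (1 / 8) D W e (1 / 100) 0 M z) c

/-- The split is a case distinction: `TightFree ⟺ F1^D ∧ F2^D`. [folklore] -/
theorem tightFreeMotifPricingCap_iff_pieces {ρ ϱ D : ℝ} {W : ℝ → ℝ} {e : ℝ} :
    TightFreeMotifPricingCap ρ ϱ D W e ↔ StrainedPatchMotifPricingCap ρ ϱ D W e ∧ TightFreeDefectMotifPricingCap ρ ϱ D W e := by
  constructor
  · exact fun h => ⟨fun M z hz hs c hconf ht _ => h M z hz hs c hconf ht, fun M z hz hs c hconf ht _ => h M z hz hs c hconf ht⟩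
  · rintro ⟨h1, h2⟩ M z hz hs c hconf ht
    by_cases hb : BadNearCap ρ D z c
    · exact h2 M z hz hs c hconf ht hb
    · exact h1 M z hz hs c hconf ht hb

/-- ★ **`C_T ≥ C_T⁰ ∧ TightFreeMotifPricingCap ⟹ LAP^D on motifs`** (any admissible instance `CutBounds W R B`, `ρ ≥ 0`). [folklore] -/
theorem ballAveragedMotifPricingCap_of_tightFree {W : ℝ → ℝ} {R B e ρ ϱ CT D : ℝ} (hW : CutBounds W R B) (hρ : 0 ≤ ρ)
    (hCT : CT₀ R B e ρ ≤ CT) (h : TightFreeMotifPricingCap ρ ϱ D W e) :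
    BallAveragedMotifPricingCap ρ ϱ (1 / 20) (1 / 8) D W e (1 / 100) CT := by
  intro M z hz hs c hconf
  by_cases ht : TightNearCap ρ D z c
  · exact tightAbsorptionCap hW hρ hCT hs ht
  · rw [ballAvg_surplusCap_eq_of_not_tightNearCap ht]
    exact h M z hz hs c hconf ht

/-- ★ **`T′♭ ⟸ TightFreeMotifPricingCap`** for any admissible Schur cut whose `effPot` vanishes from `R' ≤ ρ₁` on (`CutBounds (effPot w ω A) R B`,
`0 ≤ ρ ≤ ρ₁`, `13/10·D + 1 ≤ ρ₁`, `ρ + ρ₁ ≤ ϱ`; `C_T := C_T⁰(R,B,eUp + A,ρ)`). [folklore chaining] -/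
theorem schurTopologicalPricing_of_tightFreeMotifCap {w ω : ℝ → ℝ} {A eUp R B R' ρ ρ₁ ϱ D : ℝ} (hWB : CutBounds (effPot w ω A) R B)
    (hW : ∀ r, R' ≤ r → effPot w ω A r = 0) (h0 : 0 ≤ ρ) (hρ : ρ ≤ ρ₁) (hR : R' ≤ ρ₁) (hD : 13 / 10 * D + 1 ≤ ρ₁) (hϱ : ρ + ρ₁ ≤ ϱ)
    (h : TightFreeMotifPricingCap ρ ϱ D (effPot w ω A) (eUp + A)) :
    SchurTopologicalPricing (1 / 20) (1 / 8) w ω A eUp (1 / 100) (CT₀ R B (eUp + A) ρ) :=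
  schurTopologicalPricing_of_ballAveragedMotifCap hW (by norm_num) (by norm_num) h0 hρ hR hD hϱ (by norm_num)
    ((Dfl_pos hWB.range_nonneg hWB.floor_nonneg).le.trans (Dfl_le_CT₀ hWB.range_nonneg hWB.floor_nonneg ρ))
    (ballAveragedMotifPricingCap_of_tightFree hWB h0 le_rfl h)

/-! ## §9. The record node BY NAME: the `C_T`-free finite motif family beneath `T′♭₄₅` -/

/-- ★ **`T′♭₄₅(1/100, C_T⁴⁵(ρ)) ⟸ TightFreeMotifPricingCap ρ ϱ D W₄₅ e₄₅`** (`0 ≤ ρ ≤ ρ₁`, `9/2 ≤ ρ₁`, `13/10·D + 1 ≤ ρ₁`, `ρ + ρ₁ ≤ ϱ`).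
[folklore chaining] -/
theorem schurTopologicalPricing_fourHalf_of_tightFreeMotifCap {ρ ρ₁ ϱ D : ℝ} (h0 : 0 ≤ ρ) (hρ : ρ ≤ ρ₁) (hR : 9 / 2 ≤ ρ₁)
    (hD : 13 / 10 * D + 1 ≤ ρ₁) (hϱ : ρ + ρ₁ ≤ ϱ)
    (h : TightFreeMotifPricingCap ρ ϱ D (effPot w₄₅ ω₄ (3 / 400)) (-(7175 / 10000) + 3 / 400)) :
    SchurTopologicalPricing (1 / 20) (1 / 8) w₄₅ ω₄ (3 / 400) (-(7175 / 10000)) (1 / 100) (CT₀ (9 / 2) 1 (-(7175 / 10000) + 3 / 400) ρ) :=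
  schurTopologicalPricing_of_tightFreeMotifCap W₄₅_cutBounds (fun _ hr => effPot_fourHalf_eq_zero _ hr) h0 hρ hR hD hϱ h

/-- ★★ **The crux `AperiodicFrustratedLawGap` (stmt-27623) BY NAME from the `C_T`-FREE FINITE MOTIF FAMILY of the flat averaging rule**:
`MuEquilibriumDoor ∧ SF₄₅ ∧ UP(−0.7175) ∧ E′♭₄₅(1/1000, C_E, D_E) ∧ TightFreeMotifPricingCap ρ ϱ D W₄₅ e₄₅ ⟹ AperiodicFrustratedLawGap`
(`0 ≤ ρ ≤ ρ₁`, `9/2 ≤ ρ₁`, `13/10·D + 1 ≤ ρ₁`, `ρ + ρ₁ ≤ ϱ`). [folklore chaining] -/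
theorem aperiodicFrustratedLawGap_fourHalf_of_tightFreeMotifCap {CE DE ρ ρ₁ ϱ D : ℝ}
    (hDoor : Summit.AtomisticToContinuum.Crystallization.Theses.GrainCoreNetworkSplit.MuEquilibriumDoor)
    (hSF : SF₄₅) (hU : PeriodicEnergyCeiling (-(7175 / 10000)))
    (hE : SchurElasticPricing (1 / 20) (1 / 8) w₄₅ ω₄ (3 / 400) (-(7175 / 10000)) (1 / 1000) CE DE)
    (h0 : 0 ≤ ρ) (hρ : ρ ≤ ρ₁) (hR : 9 / 2 ≤ ρ₁) (hD : 13 / 10 * D + 1 ≤ ρ₁) (hϱ : ρ + ρ₁ ≤ ϱ)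
    (h : TightFreeMotifPricingCap ρ ϱ D (effPot w₄₅ ω₄ (3 / 400)) (-(7175 / 10000) + 3 / 400)) :
    Summit.AtomisticToContinuum.Crystallization.Theses.FrustratedLawDichotomy.AperiodicFrustratedLawGap :=
  aperiodicFrustratedLawGap_of_split_schurCut (by norm_num) hDoor hSF hU (by norm_num)
    (schurTopologicalPricing_fourHalf_of_tightFreeMotifCap h0 hρ hR hD hϱ h) (by norm_num) hE

/-- **One-shell literal**: `ρ = 23/20`, `D = 3/2`, `ρ₁ = 9/2`, `ϱ = 113/20`. [folklore chaining] -/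
theorem aperiodicFrustratedLawGap_fourHalf_of_tightFreeMotifCap_oneShell {CE DE : ℝ}
    (hDoor : Summit.AtomisticToContinuum.Crystallization.Theses.GrainCoreNetworkSplit.MuEquilibriumDoor)
    (hSF : SF₄₅) (hU : PeriodicEnergyCeiling (-(7175 / 10000)))
    (hE : SchurElasticPricing (1 / 20) (1 / 8) w₄₅ ω₄ (3 / 400) (-(7175 / 10000)) (1 / 1000) CE DE)
    (h : TightFreeMotifPricingCap (23 / 20) (113 / 20) (3 / 2) (effPot w₄₅ ω₄ (3 / 400)) (-(7175 / 10000) + 3 / 400)) :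
    Summit.AtomisticToContinuum.Crystallization.Theses.FrustratedLawDichotomy.AperiodicFrustratedLawGap :=
  aperiodicFrustratedLawGap_fourHalf_of_tightFreeMotifCap (ρ₁ := 9 / 2) hDoor hSF hU hE (by norm_num) (by norm_num) le_rfl (by norm_num)
    (by norm_num) h

/-- **With the F1/F2 split** (concordance with lens-5 g35's pieces): `… ∧ F1^D ∧ F2^D ⟹ crux` at the record node. [folklore chaining] -/
theorem aperiodicFrustratedLawGap_fourHalf_of_motifPiecesCap {CE DE ρ ρ₁ ϱ D : ℝ}
    (hDoor : Summit.AtomisticToContinuum.Crystallization.Theses.GrainCoreNetworkSplit.MuEquilibriumDoor)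
    (hSF : SF₄₅) (hU : PeriodicEnergyCeiling (-(7175 / 10000)))
    (hE : SchurElasticPricing (1 / 20) (1 / 8) w₄₅ ω₄ (3 / 400) (-(7175 / 10000)) (1 / 1000) CE DE)
    (h0 : 0 ≤ ρ) (hρ : ρ ≤ ρ₁) (hR : 9 / 2 ≤ ρ₁) (hD : 13 / 10 * D + 1 ≤ ρ₁) (hϱ : ρ + ρ₁ ≤ ϱ)
    (h1 : StrainedPatchMotifPricingCap ρ ϱ D (effPot w₄₅ ω₄ (3 / 400)) (-(7175 / 10000) + 3 / 400))
    (h2 : TightFreeDefectMotifPricingCap ρ ϱ D (effPot w₄₅ ω₄ (3 / 400)) (-(7175 / 10000) + 3 / 400)) :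
    Summit.AtomisticToContinuum.Crystallization.Theses.FrustratedLawDichotomy.AperiodicFrustratedLawGap :=
  aperiodicFrustratedLawGap_fourHalf_of_tightFreeMotifCap hDoor hSF hU hE h0 hρ hR hD hϱ (tightFreeMotifPricingCap_iff_pieces.2 ⟨h1, h2⟩)

/-- **Range-5 twin** (`W₅ = effPot w₅ ω₅ (13/4000)`, `e₅`, `5 ≤ ρ₁`). [folklore chaining] -/
theorem aperiodicFrustratedLawGap_five_of_tightFreeMotifCap {CE DE ρ ρ₁ ϱ D : ℝ}
    (hDoor : Summit.AtomisticToContinuum.Crystallization.Theses.GrainCoreNetworkSplit.MuEquilibriumDoor)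
    (hSF : SF₅) (hU : PeriodicEnergyCeiling (-(7175 / 10000)))
    (hE : SchurElasticPricing (1 / 20) (1 / 8) w₅ ω₅ (13 / 4000) (-(7175 / 10000)) (1 / 1000) CE DE)
    (h0 : 0 ≤ ρ) (hρ : ρ ≤ ρ₁) (hR : 5 ≤ ρ₁) (hD : 13 / 10 * D + 1 ≤ ρ₁) (hϱ : ρ + ρ₁ ≤ ϱ)
    (h : TightFreeMotifPricingCap ρ ϱ D (effPot w₅ ω₅ (13 / 4000)) (-(7175 / 10000) + 13 / 4000)) :
    Summit.AtomisticToContinuum.Crystallization.Theses.FrustratedLawDichotomy.AperiodicFrustratedLawGap :=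
  aperiodicFrustratedLawGap_of_split_schurCut (by norm_num) hDoor hSF hU (by norm_num)
    (schurTopologicalPricing_of_tightFreeMotifCap W₅_cutBounds (fun _ hr => effPot_five_eq_zero _ hr) h0 hρ hR hD hϱ h) (by norm_num) hE

end Summit.AtomisticToContinuum.Crystallization.Theorems.FrustratedLawDichotomyAveragingRuleTightFree

end
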